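import Summits.AtomisticToContinuum.Crystallization.Theorems.ThreeConeCertificateSlackRigidityUniqWCert
import Summits.AtomisticToContinuum.Crystallization.Theorems.ThreeConeCertificateSlackRigidityUniqKit
import Summits.AtomisticToContinuum.Crystallization.Theorems.PalmUnimodularRigidityLayeredLawsSelectHcpRelaxedReferenceTail

/-!
# `StackingHinge` (stmt-AtomisticToContinuum-14993), line `Sketch`: stub `stub_ratioLipschitz`

The dilation ratio `r(c) = S₃(c)/S₆(c)` of the certified hcp lattice sums
`S_n(c) = hcpSumS n c = Σ_{v=(k,i,j)≠0} (Q v + k²c²)⁻ⁿ` is Lipschitz on the shape box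
`[39/50, 17/20]`.

Proof (mean-value inequality).  For `c > 0` the tree gives `S_n' = −2nc · D_n` with
`D_n = hcpSumW 1 (n+1)` (`hcpSumS_hasDerivAt`), so by the quotient rule
`r' = (−6c D₃ S₆ + 12c S₃ D₆)/S₆²`.  On the box `0 < c ≤ 1`, `S₆ ≥ 1`, `S₃, D₃, D₆ ≥ 0`, and all four
sums are antitone in `c`, hence bounded by their values at `c = 39/50`; therefore
`|r'| ≤ |−6c D₃ S₆ + 12c S₃ D₆| ≤ 6 D₃(39/50) S₆(39/50) + 12 S₃(39/50) D₆(39/50) =: L`, and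
`Convex.norm_image_sub_le_of_norm_hasDerivWithin_le` on the convex set `Icc (39/50) (17/20)` gives
`|r(c) − r(c')| ≤ L |c − c'|`.
-/

noncomputable section

namespace Summit.AtomisticToContinuum.Crystallization.Theorems.PricedHcpWindowsRatioLipschitz

open Summit.AtomisticToContinuum.Crystallization.Theorems.ExcessDecayLiouvilleCoarseGrains
open Summit.AtomisticToContinuum.Crystallization.Theorems.PalmUnimodularRigidity.LayeredLawsSelectHcp
open Summit.AtomisticToContinuum.Crystallization.Theorems.EkelandSurgeryParityUniq

/-! ## The derivative of the dilation ratio -/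

/-- `S₃' = −6c · D₃` with `D₃ = hcpSumW 1 4`, for `c > 0`. [folklore] -/
theorem ratioLipschitz_hasDerivAt_S3 {c : ℝ} (hc : 0 < c) :
    HasDerivAt (hcpSumS 3) (-(6 * c) * hcpSumW 1 4 c) c :=
  (hcpSumS_hasDerivAt (e := 3) le_rfl hc).congr_deriv (by norm_num)

/-- `S₆' = −12c · D₆` with `D₆ = hcpSumW 1 7`, for `c > 0`. [folklore] -/
theorem ratioLipschitz_hasDerivAt_S6 {c : ℝ} (hc : 0 < c) :
    HasDerivAt (hcpSumS 6) (-(12 * c) * hcpSumW 1 7 c) c :=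
  (hcpSumS_hasDerivAt (e := 6) (by norm_num) hc).congr_deriv (by norm_num)

/-- Quotient rule: the derivative of `r = S₃/S₆` at `c > 0`. [folklore] -/
theorem ratioLipschitz_hasDerivAt_ratio {c : ℝ} (hc : 0 < c) :
    HasDerivAt (fun x => hcpSumS 3 x / hcpSumS 6 x)
      ((-(6 * c) * hcpSumW 1 4 c * hcpSumS 6 c - hcpSumS 3 c * (-(12 * c) * hcpSumW 1 7 c)) /
        hcpSumS 6 c ^ 2) c :=
  (ratioLipschitz_hasDerivAt_S3 hc).fun_div (ratioLipschitz_hasDerivAt_S6 hc)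
    (hcpSumS_pos_gen (by norm_num) hc).ne'

/-! ## The uniform derivative bound on the shape box -/

/-- On `[39/50, 17/20]` the derivative of `r = S₃/S₆` is bounded in absolute value by
`L = 6 D₃(39/50) S₆(39/50) + 12 S₃(39/50) D₆(39/50)` (antitonicity of the four sums, `S₆ ≥ 1`,
`c ≤ 1`). [folklore] -/
theorem ratioLipschitz_deriv_bound {c : ℝ} (hc₁ : 39 / 50 ≤ c) (hc₂ : c ≤ 17 / 20) :
    |(-(6 * c) * hcpSumW 1 4 c * hcpSumS 6 c - hcpSumS 3 c * (-(12 * c) * hcpSumW 1 7 c)) /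
        hcpSumS 6 c ^ 2| ≤
      6 * (hcpSumW 1 4 (39 / 50) * hcpSumS 6 (39 / 50)) +
        12 * (hcpSumS 3 (39 / 50) * hcpSumW 1 7 (39 / 50)) := by
  have h0 : (0 : ℝ) < 39 / 50 := by norm_num
  have hc : 0 < c := lt_of_lt_of_le h0 hc₁
  have hc1 : c ≤ 1 := hc₂.trans (by norm_num)
  -- the four sums at `c`: signs
  have pS6 : 1 ≤ hcpSumS 6 c := hcpSum_one_le_hcpSumS_gen (by norm_num) hc
  have pS3 : 0 ≤ hcpSumS 3 c := (hcpSumS_pos_gen (by norm_num) hc).le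
  have pD3 : 0 ≤ hcpSumW 1 4 c := hcpSumW_nonneg _ _ _
  have pD6 : 0 ≤ hcpSumW 1 7 c := hcpSumW_nonneg _ _ _
  -- the four sums at `c`: upper bounds by the values at `39/50` (antitonicity)
  have aS6 : hcpSumS 6 c ≤ hcpSumS 6 (39 / 50) := hcpSumS_antitone_gen (by norm_num) h0 hc₁
  have aS3 : hcpSumS 3 c ≤ hcpSumS 3 (39 / 50) := hcpSumS_antitone_gen (by norm_num) h0 hc₁
  have aD3 : hcpSumW 1 4 c ≤ hcpSumW 1 4 (39 / 50) :=
    hcpSumW_antitone_gen (by norm_num) (by norm_num) h0 hc₁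
  have aD6 : hcpSumW 1 7 c ≤ hcpSumW 1 7 (39 / 50) :=
    hcpSumW_antitone_gen (by norm_num) (by norm_num) h0 hc₁
  -- products
  have m1 : hcpSumW 1 4 c * hcpSumS 6 c ≤ hcpSumW 1 4 (39 / 50) * hcpSumS 6 (39 / 50) :=
    mul_le_mul aD3 aS6 (zero_le_one.trans pS6) (pD3.trans aD3)
  have m2 : hcpSumS 3 c * hcpSumW 1 7 c ≤ hcpSumS 3 (39 / 50) * hcpSumW 1 7 (39 / 50) :=
    mul_le_mul aS3 aD6 pD6 (pS3.trans aS3)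
  have m1' : c * (hcpSumW 1 4 c * hcpSumS 6 c) ≤ 1 * (hcpSumW 1 4 (39 / 50) * hcpSumS 6 (39 / 50)) :=
    mul_le_mul hc1 m1 (mul_nonneg pD3 (zero_le_one.trans pS6)) zero_le_one
  have m2' : c * (hcpSumS 3 c * hcpSumW 1 7 c) ≤ 1 * (hcpSumS 3 (39 / 50) * hcpSumW 1 7 (39 / 50)) :=
    mul_le_mul hc1 m2 (mul_nonneg pS3 pD6) zero_le_one
  have n1 : 0 ≤ c * (hcpSumW 1 4 c * hcpSumS 6 c) :=
    mul_nonneg hc.le (mul_nonneg pD3 (zero_le_one.trans pS6))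
  have n2 : 0 ≤ c * (hcpSumS 3 c * hcpSumW 1 7 c) := mul_nonneg hc.le (mul_nonneg pS3 pD6)
  -- drop the denominator `S₆² ≥ 1`
  have hsq : 1 ≤ hcpSumS 6 c ^ 2 := one_le_pow₀ pS6
  rw [abs_div, abs_of_pos (lt_of_lt_of_le one_pos hsq)]
  refine (div_le_self (abs_nonneg _) hsq).trans ?_
  rw [abs_le]
  constructor
  · nlinarith [m1', n2]
  · nlinarith [m2', n1]

/-! ## The stub -/

/-- **Stub `stub_ratioLipschitz` of line `Sketch`.**  The dilation ratio `S₃/S₆` of the certified hcp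
lattice sums is Lipschitz on the shape box `[39/50, 17/20]`: with
`L = 6 D₃(39/50) S₆(39/50) + 12 S₃(39/50) D₆(39/50) ≥ 0` (an upper bound for `|r'|` on the box,
`ratioLipschitz_deriv_bound`), the mean-value inequality on the convex set `Icc (39/50) (17/20)`
gives `|r(c) − r(c')| ≤ L |c − c'|`. [folklore] -/
theorem stub_ratioLipschitz : ∃ L : ℝ, 0 ≤ L ∧ ∀ c c' : ℝ, 39 / 50 ≤ c → c ≤ 17 / 20 → 39 / 50 ≤ c' → c' ≤ 17 / 20 → |Summit.AtomisticToContinuum.Crystallization.Theorems.ExcessDecayLiouvilleCoarseGrains.hcpSumS 3 c / Summit.AtomisticToContinuum.Crystallization.Theorems.ExcessDecayLiouvilleCoarseGrains.hcpSumS 6 c - Summit.AtomisticToContinuum.Crystallization.Theorems.ExcessDecayLiouvilleCoarseGrains.hcpSumS 3 c' / Summit.AtomisticToContinuum.Crystallization.Theorems.ExcessDecayLiouvilleCoarseGrains.hcpSumS 6 c'| ≤ L * |c - c'| := by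
  set L : ℝ := 6 * (hcpSumW 1 4 (39 / 50) * hcpSumS 6 (39 / 50)) +
    12 * (hcpSumS 3 (39 / 50) * hcpSumW 1 7 (39 / 50)) with hL
  have h0 : (0 : ℝ) < 39 / 50 := by norm_num
  have hL0 : 0 ≤ L :=
    add_nonneg (mul_nonneg (by norm_num) (mul_nonneg (hcpSumW_nonneg _ _ _)
      (hcpSumS_pos_gen (by norm_num) h0).le))
      (mul_nonneg (by norm_num) (mul_nonneg (hcpSumS_pos_gen (by norm_num) h0).le
        (hcpSumW_nonneg _ _ _)))
  refine ⟨L, hL0, fun c c' hc₁ hc₂ hc'₁ hc'₂ => ?_⟩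
  -- mean-value inequality on the convex set `Icc (39/50) (17/20)`
  have hderiv : ∀ x ∈ Set.Icc (39 / 50 : ℝ) (17 / 20),
      HasDerivWithinAt (fun x => hcpSumS 3 x / hcpSumS 6 x)
        ((-(6 * x) * hcpSumW 1 4 x * hcpSumS 6 x - hcpSumS 3 x * (-(12 * x) * hcpSumW 1 7 x)) /
          hcpSumS 6 x ^ 2) (Set.Icc (39 / 50 : ℝ) (17 / 20)) x :=
    fun x hx => (ratioLipschitz_hasDerivAt_ratio (lt_of_lt_of_le h0 hx.1)).hasDerivWithinAt
  have hbound : ∀ x ∈ Set.Icc (39 / 50 : ℝ) (17 / 20),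
      ‖(-(6 * x) * hcpSumW 1 4 x * hcpSumS 6 x - hcpSumS 3 x * (-(12 * x) * hcpSumW 1 7 x)) /
          hcpSumS 6 x ^ 2‖ ≤ L := fun x hx => by
    rw [Real.norm_eq_abs, hL]
    exact ratioLipschitz_deriv_bound hx.1 hx.2
  have key := (convex_Icc (39 / 50 : ℝ) (17 / 20)).norm_image_sub_le_of_norm_hasDerivWithin_le
    hderiv hbound ⟨hc'₁, hc'₂⟩ ⟨hc₁, hc₂⟩
  rw [Real.norm_eq_abs, Real.norm_eq_abs] at key
  exact key

end Summit.AtomisticToContinuum.Crystallization.Theorems.PricedHcpWindowsRatioLipschitz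

end
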